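import Summits.PneNP.PneNP.Theorems.PermanentDescentCollapseMakesPermanentEasyDefs
import Mathlib.Data.Nat.Bitwise
import Literature.Computability.Complexity.TM2PassThrough
import Literature.Computability.Complexity.StackWordArith
import Literature.Computability.AlgebraicComplexity.PermanentBitsPPoly

/-!
# Route PermanentDescent, crux `CollapseMakesPermanentEasy` (stmt-PneNP-16142), line `birth` v2 — `stub_completeT`

Registered stub `stub_completeT` of the skeleton `Cruxes/CollapseMakesPermanentEasy/Lines/birth.lean` (v2), over the
objects of `Theorems/PermanentDescentCollapseMakesPermanentEasyDefs.lean` (namespace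
`Summit.PneNP.PneNP.Theorems.PermCert`). COMPLETENESS of the Laplace certificate: the table of the
true advice strings `advTable a n` is good (`GoodT`) with bit budget `B = n² + 1` at every square word of
length `≤ n²`.

Proof. (1) Table lookup: a query `⟨s, bin i⟩` with `|s| = m² ≤ n²`, `i < B` has length
`2m² + 2 + |bin i| < tabLen n` (`|bin i| = size i ≤ n² + 1`), so the table entry at its length is the true
advice string and the answer is the true bit `(permWord m s).testBit i` (`ansT_advTable`). (2) Since
`permWord m s ≤ m! < 2^{m²+1} ≤ 2^B`, reading back the `B` answers gives `valT = permWord m s`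
(`valT_advTable`, via the tree's `Com.testBit_bitsToNat`). (3) At a square word of side `0` the
certified right-hand side is `1 = permWord 0 s`; at side `k + 1` it is the Laplace sum over the
minors (words of length `k² ≤ n²`, whose values are again permanents by (2)), which is
`permWord (k+1) s` by the Laplace identity in the word encoding (the hypotheses, content of
`stub_laplaceWord`).
-/

set_option linter.dupNamespace false -- `Summit.PneNP.PneNP.…`: summit = sub-problem name (D-0017 single-conjunct layout)

namespace Summit.PneNP.PneNP.Theorems.PermCert

open _root_.Computability Polynomial
open Literature.Computability.Complexity Literature.Computability.Complexity.Brick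

/-! ### Reading binary digits back -/

/-- Reading back a `B`-bit field: the number whose digits (least significant first) are the bits
`testBit v 0, …, testBit v (B-1)` is `v`, provided `v < 2^B` (bit `t` of `bitsToNat l` is entry `t`,
the tree's `Com.testBit_bitsToNat`). [folklore] -/
theorem bitsToNat_map_testBit_range {B v : ℕ} (h : v < 2 ^ B) :
    bitsToNat ((List.range B).map v.testBit) = v := by
  apply Nat.eq_of_testBit_eq
  intro t
  rw [Com.testBit_bitsToNat, List.getD_eq_getElem?_getD, List.getElem?_map]
  by_cases ht : t < B
  · rw [List.getElem?_range ht]; rfl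
  · rw [List.getElem?_eq_none (by simpa using not_lt.1 ht)]
    exact (Nat.testBit_eq_false_of_lt
      (lt_of_lt_of_le h (Nat.pow_le_pow_right (by norm_num) (not_lt.1 ht)))).symm

/-! ### The permanent of a matrix word is small -/

/-- `permWord m s < 2^{m·m+1}`: the permanent of a `0/1` matrix counts permutations
(`permanent_of_bool`), so it is at most `m! < 2^{m²+1}`. [folklore] -/
theorem permWord_lt_two_pow_aux (m : ℕ) (s : List Bool) : permWord m s < 2 ^ (m * m + 1) := by
  have h := Literature.Computability.AlgebraicComplexity.permanent_of_bool ℕ m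
    (fun ab => s.getD ((ab.2 : ℕ) + m * (ab.1 : ℕ)) false)
  have hle := Literature.Computability.AlgebraicComplexity.permCount_le_factorial m
    (fun ab => s.getD ((ab.2 : ℕ) + m * (ab.1 : ℕ)) false)
  have hfac := Literature.Computability.AlgebraicComplexity.factorial_lt_two_pow_mul_succ m
  have hperm : permWord m s = Literature.Computability.AlgebraicComplexity.permCount m
      (fun ab => s.getD ((ab.2 : ℕ) + m * (ab.1 : ℕ)) false) := by
    rw [permWord, matOfWord,
      ← Nat.cast_id (Literature.Computability.AlgebraicComplexity.permCount m _), ← h]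
  rw [hperm]
  omega

/-! ### Table lookup and values of the true table -/

/-- **Table lookup.** If `χ` with the advice `a` answers every bit query by the true bit, then the
table of the true advice strings `advTable a n` answers the query `⟨s, bin i⟩` (`|s| = m² ≤ n²`,
`i ≤ n²`) by the true bit: the query has length `2m² + 2 + size i < tabLen n`, so the table entry at
that length is `a` of it. [folklore] -/
theorem ansT_advTable (χ : List Bool → Bool) (a : ℕ → List Bool) (n : ℕ)
    (hχ : ∀ (m : ℕ) (s : List Bool) (i : ℕ), s.length = m * m →
      χ (boolPair (boolPair s (encodeNat i)) (a (boolPair s (encodeNat i)).length)) = (permWord m s).testBit i)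
    {m : ℕ} {s : List Bool} {i : ℕ} (hs : s.length = m * m) (hm : m * m ≤ n * n) (hi : i < n * n + 1) :
    ansT χ (advTable a n) s i = (permWord m s).testBit i := by
  have hsize : i.size ≤ n * n + 1 := Nat.size_le.2 (hi.trans Nat.lt_two_pow_self)
  have hlen : (boolPair s (encodeNat i)).length < tabLen n := by
    rw [length_boolPair, TM2Pass.length_encodeNat_eq_size, hs, tabLen]
    omega
  have hget : (advTable a n).getD (boolPair s (encodeNat i)).length [] =
      a (boolPair s (encodeNat i)).length := by
    rw [advTable, List.getD_eq_getElem?_getD, List.getElem?_map, List.getElem?_range hlen]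
    rfl
  rw [ansT, hget]
  exact hχ m s i hs

/-- **Values of the true table are permanents.** For `|s| = m² ≤ n²`, the value read off
`advTable a n` with bit budget `n² + 1` is `permWord m s` (all its bits lie below `m² + 1 ≤ n² + 1`). [folklore] -/
theorem valT_advTable (χ : List Bool → Bool) (a : ℕ → List Bool) (n : ℕ)
    (hχ : ∀ (m : ℕ) (s : List Bool) (i : ℕ), s.length = m * m →
      χ (boolPair (boolPair s (encodeNat i)) (a (boolPair s (encodeNat i)).length)) = (permWord m s).testBit i)
    {m : ℕ} {s : List Bool} (hs : s.length = m * m) (hm : m * m ≤ n * n) :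
    valT χ (advTable a n) (n * n + 1) s = permWord m s := by
  have hmap : ((List.range (n * n + 1)).map fun i => ansT χ (advTable a n) s i) =
      (List.range (n * n + 1)).map (permWord m s).testBit := by
    apply List.map_congr_left
    intro i hi
    rw [List.mem_range] at hi
    exact ansT_advTable χ a n hχ hs hm hi
  have hlt : permWord m s < 2 ^ (n * n + 1) :=
    (permWord_lt_two_pow_aux m s).trans_le (Nat.pow_le_pow_right (by norm_num) (by omega))
  rw [valT, hmap]
  exact bitsToNat_map_testBit_range hlt

/-! ### Completeness -/

/-- **Completeness of the Laplace certificate (Stub C of the line `birth`).** If the advice-taking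
predicate `χ` with the advice `a` answers every bit query `⟨s, bin i⟩` (`|s| = m²`) by bit `i` of
`permWord m s`, then the table of the true advice strings `advTable a n` is good with bit budget
`n² + 1` up to length `n²`: its values are the permanents (`valT_advTable`), and these satisfy the
Laplace test — `1` at the empty word, the row-`0` expansion over the minors at side `k + 1` (the two
Laplace hypotheses, content of `stub_laplaceWord`). Search-to-decision under a collapse:
R. M. Karp, R. J. Lipton, STOC 1980, Thm. 6.1; Laplace expansion of the permanent: H. Minc,
*Permanents* (1978), §1.2. [folklore] -/
theorem stub_completeT :
    ∀ (χ : List Bool → Bool) (a : ℕ → List Bool) (n : ℕ),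
      (∀ s : List Bool, permWord 0 s = 1) →
      (∀ (k : ℕ) (s : List Bool), permWord (k + 1) s = laplaceSum k s (permWord k)) →
      (∀ (m : ℕ) (s : List Bool) (i : ℕ), s.length = m * m →
        χ (boolPair (boolPair s (encodeNat i)) (a (boolPair s (encodeNat i)).length)) = (permWord m s).testBit i) →
      GoodT χ (advTable a n) (n * n + 1) (n * n) := by
  intro χ a n hL0 hLap hχ s hsq hle
  obtain ⟨m, hm⟩ : ∃ m, Nat.sqrt s.length = m := ⟨_, rfl⟩
  rw [hm] at hsq
  have hs : s.length = m * m := hsq.symm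
  have hmn : m * m ≤ n * n := hs ▸ hle
  rw [valT_advTable χ a n hχ hs hmn, rhsT, hm]
  cases m with
  | zero =>
    have h0 : s.length = 0 := by rw [hs]
    rw [if_pos h0]
    exact hL0 s
  | succ k =>
    have h0 : ¬ s.length = 0 := by rw [hs]; simp
    rw [if_neg h0, Nat.add_sub_cancel, hLap k s, laplaceSum, laplaceSum]
    congr 1
    apply List.map_congr_left
    intro j _
    split_ifs
    · have hk : k * k ≤ n * n := (Nat.mul_self_le_mul_self (Nat.le_succ k)).trans hmn
      rw [valT_advTable χ a n hχ (by simp [minorWord]) hk]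
    · rfl

end Summit.PneNP.PneNP.Theorems.PermCert
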